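import Summits.PneNP.PneNP.Theses.PermanentDescent
import Literature.Computability.AlgebraicComplexity.PermanentBitsPPoly
import Literature.Computability.AlgebraicComplexity.ValiantHardnessJunctions
import Literature.Computability.QuantumComplexity.PermanentHardness
import Literature.Computability.Complexity.ReductionsProofs
import Literature.Computability.Complexity.PRelSigmaPi
import Literature.Computability.Complexity.PPolyTuringClosure
import Literature.Computability.Complexity.FoldBricks
import Literature.Computability.Complexity.CountingHierarchyPH
import Literature.Computability.Complexity.CountingProofs

/-!
# `PermanentNotInP` (crux stmt-PneNP-16143, route `PermanentDescent`): a counter-model to the crux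
# collapses the counting classes — `¬ PermanentNotInP → PP ⊆ P → NP ⊆ P → ¬ PneNP`
# (negative-side support, crux-disprover seat; this file does NOT refute the crux)

The crux `Summit.PneNP.PneNP.Theses.PermanentDescent.PermanentNotInP` says `PermBits ∉ P` for the
bit-graph language `PermBits = {⟨s, bin i⟩ : s ∈ {0,1}^{n·n}, bit i of perm_ℕ(M_s) = 1}` of the `0/1`
permanent (row-major `M_s`). We record, sorry-free and without defining any proposition under
`Summits/` (the language is written inline, exactly as in the route file), what a refutation of the
crux would entail inside the tree:

* `testBit_per01PlainFn_iff_mem` — the bits of the tree's row-major `0/1` permanent function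
  `per01PlainFn` (`AlgebraicComplexity/PermanentBitsPPoly.lean`) are exactly the memberships in
  `PermBits` (square words: `permanent_of_bool`; non-square words: both sides empty);
* `preimage_pairFn_permBits` — hence the `FP` transcoder `⟨x, u⟩ ↦ ⟨x, bin |u|⟩`
  (`pairFn fstP (lenBinF ∘ sndP)`) pulls `PermBits` back to the unary-indexed bit graph
  `bitLang per01PlainFn` of `PPolyTuringClosure.lean`;
* `PP_subset_P_of_not_permanentNotInP` — `¬ crux`, i.e. `PermBits ∈ P`, gives `bitLang per01PlainFn ∈ P`
  (`preimage_mem_P`), so `P^{per01PlainFn} ⊆ P^{bitLang} ⊆ P` (`PRel_ofFun_subset_PRel_bitLang`,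
  `PRelClass_P_subset_P`), and Valiant's theorem — DISCHARGED in the tree as
  `ValiantFP.isSharpPHardFun_per01PlainFn` — gives `PP ⊆ P^{#P} ⊆ P^{per01PlainFn}`
  (`PP_subset_PSharpP_holds`, `PSharpP_subset_PRel_ofFun_of_isSharpPHardFun`): `PP ⊆ P`;
* `NP_subset_P_of_not_permanentNotInP`, `not_pneNP_of_not_permanentNotInP` — with `NP ⊆ PP`
  (`NP_subset_PP_holds`) and the model bridges `P_bool_eq_holds`, `np_bool_eq`: `¬ crux → ¬ PneNP`.

Moral for the crux chain: there is no cheap kill of this crux — every counter-model is a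
polynomial-time machine for the `0/1` permanent, i.e. a proof of `P = PP` (hence `P = NP`): the crux is
implied by the summit (first observed by refuter-rattack-stmt-PneNP-16143-0, evidence SimpC.lean,
2026-08-17; re-derived here so that it is importable). Conversely nothing here helps to PROVE the crux.

References: L. G. Valiant, *The complexity of computing the permanent*, TCS 8 (1979) 189–201, Thm. 1;
S. Arora, B. Barak, *Computational Complexity* (2009), §17.2.1, Thm. 17.11.
-/

noncomputable section

set_option linter.dupNamespace false

namespace Summit.PneNP.PneNP.Theorems.PermanentNotInP.Negative

open Literature.Computability.Complexity Literature.Computability.AlgebraicComplexity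
open Summit.PneNP.PneNP.Theses.PermanentDescent Computability

/-- The crux's row-major matrix has permanent `permCount n (wordBits s n)` (`b + n·a = a·n + b`).
[cite: Valiant1979, §1] -/
theorem permanent_rowMajor_eq_permCount (n : ℕ) (s : List Bool) :
    (Matrix.of fun a b : Fin n => if s.getD ((b : ℕ) + n * (a : ℕ)) false then (1 : ℕ) else 0).permanent =
      permCount n (wordBits s n) := by
  have h : (Matrix.of fun a b : Fin n => if s.getD ((b : ℕ) + n * (a : ℕ)) false then (1 : ℕ) else 0) =
      Matrix.of fun i j : Fin n => if wordBits s n (i, j) then (1 : ℕ) else 0 := by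
    ext i j
    simp [wordBits, Nat.mul_comm, Nat.add_comm]
  rw [h]
  exact_mod_cast permanent_of_bool ℕ n (wordBits s n)

/-- **The bits of `per01PlainFn` are the memberships in `PermBits`.** [cite: Valiant1979, Thm. 1] -/
theorem testBit_per01PlainFn_iff_mem (x : List Bool) (i : ℕ) :
    (per01PlainFn x).testBit i = true ↔
      boolPair x (encodeNat i) ∈ ({w | ∃ (n : ℕ) (s : List Bool) (i : ℕ), s.length = n * n ∧
        w = boolPair s (encodeNat i) ∧ Nat.testBit (Matrix.permanent (Matrix.of fun a b : Fin n =>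
          if s.getD ((b : ℕ) + n * (a : ℕ)) false then (1 : ℕ) else 0)) i = true} : Language Bool) := by
  constructor
  · intro hbit
    by_cases hsq : ∃ n, x.length = n * n
    · obtain ⟨n, hn⟩ := hsq
      refine ⟨n, x, i, hn, rfl, ?_⟩
      rwa [per01PlainFn_of_sq hn, ← permanent_rowMajor_eq_permCount] at hbit
    · rw [per01PlainFn_of_not_sq (fun h => hsq ⟨_, h.symm⟩), Nat.zero_testBit] at hbit
      exact absurd hbit Bool.false_ne_true
  · rintro ⟨n, s, j, hs, hw, hbit⟩
    have h := boolPair_injective (a₁ := (x, encodeNat i)) (a₂ := (s, encodeNat j)) hw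
    obtain ⟨rfl, hij⟩ := Prod.mk.inj h
    have hji : i = j := by simpa [decode_encodeNat] using congrArg decodeNat hij
    subst hji
    rwa [per01PlainFn_of_sq hs, ← permanent_rowMajor_eq_permCount]

/-- **The transcoder** `⟨x, u⟩ ↦ ⟨x, bin |u|⟩` (an `FP` map: `pairFn_mem_FP`, `lenBinF_mem_FP`) pulls
`PermBits` back to the tree's bit graph `bitLang per01PlainFn`. [cite: Valiant1979, Thm. 1] -/
theorem preimage_pairFn_permBits :
    (pairFn fstP (Brick.lenBinF ∘ sndP)) ⁻¹'
      ({w | ∃ (n : ℕ) (s : List Bool) (i : ℕ), s.length = n * n ∧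
        w = boolPair s (encodeNat i) ∧ Nat.testBit (Matrix.permanent (Matrix.of fun a b : Fin n =>
          if s.getD ((b : ℕ) + n * (a : ℕ)) false then (1 : ℕ) else 0)) i = true} : Language Bool) =
      bitLang per01PlainFn := by
  ext z
  simp only [Set.mem_preimage, pairFn_apply, Function.comp_apply, Brick.lenBinF_apply, bitLang]
  exact (testBit_per01PlainFn_iff_mem (fstP z) (sndP z).length).symm

/-- **`¬ PermanentNotInP → PP ⊆ P`**: a counter-model to the crux puts the bit graph of the `0/1`
permanent in `P`, and Valiant's theorem (tree: `ValiantFP.isSharpPHardFun_per01PlainFn`) with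
`PP ⊆ P^{#P}` collapses `PP` to `P`. [cite: Valiant1979, Thm. 1] -/
theorem PP_subset_P_of_not_permanentNotInP (h : ¬ PermanentNotInP) : PP ⊆ Classes.P := by
  have hP : ({w | ∃ (n : ℕ) (s : List Bool) (i : ℕ), s.length = n * n ∧
      w = boolPair s (encodeNat i) ∧ Nat.testBit (Matrix.permanent (Matrix.of fun a b : Fin n =>
        if s.getD ((b : ℕ) + n * (a : ℕ)) false then (1 : ℕ) else 0)) i = true} : Language Bool) ∈
      Classes.P := Classical.not_not.mp h
  have hbit : bitLang per01PlainFn ∈ Classes.P := by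
    rw [← preimage_pairFn_permBits]
    exact preimage_mem_P hP (pairFn_mem_FP fstP_mem_FP (comp_mem_FP Brick.lenBinF_mem_FP sndP_mem_FP))
  have h1 : PRel (Oracle.ofLanguage (bitLang per01PlainFn)) ⊆ Classes.P := fun L hL =>
    PRelClass_P_subset_P (mem_PRelClass_iff.2 ⟨_, hbit, hL⟩)
  have h2 : PRel (Oracle.ofFun per01PlainFn) ⊆ PRel (Oracle.ofLanguage (bitLang per01PlainFn)) :=
    PRel_ofFun_subset_PRel_bitLang per01PlainFn (Polynomial.X + 1)
      (fun x => by simpa using per01PlainFn_lt_two_pow x)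
  have h3 : PSharpP ⊆ PRel (Oracle.ofFun per01PlainFn) :=
    Literature.Computability.QuantumComplexity.PSharpP_subset_PRel_ofFun_of_isSharpPHardFun
      ValiantFP.isSharpPHardFun_per01PlainFn
  exact fun _ hL => h1 (h2 (h3 (PP_subset_PSharpP_holds hL)))

/-- **`¬ PermanentNotInP → NP ⊆ P`** (`NP ⊆ PP`, `NP_subset_PP_holds`). [cite: Valiant1979, Thm. 1] -/
theorem NP_subset_P_of_not_permanentNotInP (h : ¬ PermanentNotInP) :
    Nondeterministic.NP ⊆ Classes.P :=
  fun _ hL => PP_subset_P_of_not_permanentNotInP h (NP_subset_PP_holds hL)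

/-- **`¬ PermanentNotInP → ¬ PneNP`: a refutation of the crux decides the summit negatively**
(the crux is implied by the summit; model bridges `P_bool_eq_holds`, `np_bool_eq`).
[cite: Valiant1979, Thm. 1] -/
theorem not_pneNP_of_not_permanentNotInP (h : ¬ PermanentNotInP) : ¬ _root_.PneNP := by
  have hPeq : PNPWave0.P Bool = Classes.P := P_bool_eq_holds
  have hNeq : PNPWave0.NP Bool = Nondeterministic.NP := np_bool_eq
  rintro ⟨L, hL, hL'⟩
  rw [hNeq] at hL
  rw [hPeq] at hL'
  exact hL' (NP_subset_P_of_not_permanentNotInP h hL)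

end Summit.PneNP.PneNP.Theorems.PermanentNotInP.Negative

end
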